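import Summits.QuantumAdvantage.QuantumAdvantage.Theorems.CubicForrelationNearExactIsExactTwelveLevelSixBothGt930Dead
import Summits.QuantumAdvantage.QuantumAdvantage.Theorems.CubicForrelationNearExactIsExactTwelveTypeO931Shape
import Summits.QuantumAdvantage.QuantumAdvantage.Theorems.CubicForrelationNearExactIsExactTwelveClosed932

/-!
# Crux `CubicForrelation.NearExactIsExact` (stmt-QuantumAdvantage-14043) — n = 12: the rungs `931/1024` AND `930.5/1024` are CLOSED; `θ₁₂ ≤ 930/1024`

Certificate seat `b2b-cforr-cert` (gen 20).  HONEST FRAMING: a DECIDABLE VERDICT (kernel-checked, standard axioms, no `decide`) on the finite ladder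
at `n = 12`: NO cubic pair on 12 bits has `930/1024 < Φ < 1`, so `θ₁₂ ∈ [57/64, 930/1024] = [912/1024, 930/1024]`; the 18 values
`913/1024, …, 930/1024` (and the finer grid points `k/16384`, `14593 ≤ k ≤ 14880`) remain undecided.  NOT summit progress (the crux asks for ONE
`θ < 1` uniform in `n`).

Assembly of: `to19_window_gt930_levelSix` (…TwelveTypeO931Shape, gen 19: above `930/1024` both sides are at Ax level `≥ 6` — type O dead by
the Kasami–Tokura-for-cubics base-set analysis, level 5 dead by gen 18's cascade) and `tw20_levelSix_both_gt930_false` (…TwelveLevelSixBothGt930Dead,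
gen 20: level `≥ 6` × level `≥ 6` is dead above `930/1024` — off-flat trichotomy at every energy `< 240` with up to three exceptional points).

* `tw20_window_gt930_false` / `isolation_twelve_gt_930`: `Φ > 930/1024 ⇒ Φ = 1` for cubic pairs on 12 bits.
* `isolation_twelve_ge_931`: the rung `931/1024` (`Φ ≥ 931/1024 ⇒ Φ = 1`).
* `theta_twelve_le_930`: `θ₁₂ ∈ [57/64, 930/1024]`.
* `no_window_twelve_gt_930`: no cubic pair on 12 bits has `930/1024 < Φ < 1`.

WHAT IS NEXT (not claimed): the value `930/1024 = 465/512` itself — type O with base set `992` and zero excess (`to19_typeO_ge930_shape`) against a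
level-5 partner, level 5 at budget `Σ_P(e² − 1) ≤ 1023`, level `≥ 6` × level `≥ 6` at `Σ e² = 752` (off-flat energy `≤ 240`: a fourth exceptional
point / `#U = 48` with four `e = ±4` become possible).

References: Ax (1964) / McEliece (1972); MacWilliams–Sloane (1977) Ch. 13–15; Kasami–Tokura (1970) (via the tree's own proof
`kt3_structure_twelve`).  Everything below is proved from Mathlib and the tree; axioms are the standard three.
-/

set_option linter.dupNamespace false -- D-0017: single-problem summit ⇒ `QuantumAdvantage.QuantumAdvantage` by design

noncomputable section

namespace Summit.QuantumAdvantage.QuantumAdvantage.Theorems.CubicForrelation.NearExactIsExact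

open Finset
open Literature.Computability.QuantumComplexity

/-- **The window `(930/1024, 1)` is EMPTY at `n = 12`**: cubic `f, g` on `6 + 6` bits with `930/1024 < Φ(f,g) < 1` do not exist (both sides are
at level `≥ 6` by `to19_window_gt930_levelSix`, and such pairs are dead by `tw20_levelSix_both_gt930_false`).  Finite-slice statement, NOT
summit progress. [this work] -/
theorem tw20_window_gt930_false (f g : (Fin (6 + 6) → Bool) → Bool) (hf : IsDegLeFun 3 f) (hg : IsDegLeFun 3 g)
    (hlo : (930 / 1024 : ℝ) < forrelation f g) (hhi : forrelation f g < 1) : False := by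
  obtain ⟨⟨u'', hu''⟩, ⟨w, hw⟩⟩ := to19_window_gt930_levelSix f g hf hg hlo
  exact tw20_levelSix_both_gt930_false f g hf hg u'' hu'' w hw hlo hhi

/-- **`Φ > 930/1024 ⇒ Φ = 1`** for cubic pairs on 12 bits.  NOT summit progress. [this work] -/
theorem tw20_gt930_eq_one (f g : (Fin 12 → Bool) → Bool) (hf : IsDegLeFun 3 f) (hg : IsDegLeFun 3 g)
    (hΦ : (930 / 1024 : ℝ) < forrelation f g) : forrelation f g = 1 := by
  have hle : forrelation f g ≤ 1 := (abs_le.1 (SgnForrMem.abs_forrelation_le_one f g)).2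
  rcases hle.lt_or_eq with hlt | heq
  · exact (tw20_window_gt930_false f g hf hg hΦ hlt).elim
  · exact heq

/-- **Isolation above `930/1024`** on 12 bits (packaging): `θ₁₂ ≤ 930/1024`. [this work] -/
theorem isolation_twelve_gt_930 : ∀ f g : (Fin 12 → Bool) → Bool, IsDegLeFun 3 f → IsDegLeFun 3 g →
    (930 / 1024 : ℝ) < forrelation f g → forrelation f g = 1 :=
  fun f g hf hg h => tw20_gt930_eq_one f g hf hg h

/-- **The rung `931/1024` is closed**: `Φ ≥ 931/1024 ⇒ Φ = 1` for cubic pairs on 12 bits. [this work] -/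
theorem isolation_twelve_ge_931 : ∀ f g : (Fin 12 → Bool) → Bool, IsDegLeFun 3 f → IsDegLeFun 3 g →
    (931 / 1024 : ℝ) ≤ forrelation f g → forrelation f g = 1 :=
  fun f g hf hg h => tw20_gt930_eq_one f g hf hg (by linarith)

/-- **`θ₁₂ ≤ 930/1024`**, i.e. `θ₁₂ ∈ [57/64, 930/1024]`: the least isolation threshold for cubic pairs on 12 bits is at least the record
`57/64 = 912/1024` (`theta_twelve_bounds`) and at most `930/1024` (`isolation_twelve_gt_930`).  Finite-slice verdict, NOT summit progress.
[this work] -/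
theorem theta_twelve_le_930 : ∃ θ₀ : ℝ, 57 / 64 ≤ θ₀ ∧ θ₀ ≤ 930 / 1024 ∧
    IsLeast {θ : ℝ | ∀ f g : (Fin 12 → Bool) → Bool, IsDegLeFun 3 f → IsDegLeFun 3 g →
      θ < forrelation f g → forrelation f g = 1} θ₀ := by
  obtain ⟨θ₀, hθ₀⟩ := theta_exists 12
  exact ⟨θ₀, theta_twelve_bounds.2 θ₀ hθ₀.1, hθ₀.2 isolation_twelve_gt_930, hθ₀⟩

/-- **No cubic pair on 12 bits has `930/1024 < Φ < 1`.** [this work] -/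
theorem no_window_twelve_gt_930 : ¬ ∃ f g : (Fin 12 → Bool) → Bool, IsDegLeFun 3 f ∧ IsDegLeFun 3 g ∧
    (930 / 1024 : ℝ) < forrelation f g ∧ forrelation f g < 1 := by
  rintro ⟨f, g, hf, hg, hlo, hhi⟩
  have h := tw20_gt930_eq_one f g hf hg hlo
  rw [h] at hhi
  exact lt_irrefl _ hhi

end Summit.QuantumAdvantage.QuantumAdvantage.Theorems.CubicForrelation.NearExactIsExact

end
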